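import Summits.HodgeConjecture.CorCM.CycleClassFacts
import Summits.HodgeConjecture.HodgeConjecture.Theorems.EndoscopicMiddleDegreeCupProductAlgebraic
import HarnessLib

/-!
# COR-CM model layer, part 5: cup products of rational algebraic classes in all codimensions
# (`Fact_cupAlg`, fact F4) on the Picard–CM model universe

Cell `pub-hodgecm2` (COR-CM), seat `model-1`; row Fg4 of `BINDER-OWNERS.md` = stage-1 fact F4 `Fact_cupAlg`
(`HodgeCM/StubTree/Qw8GeometricBlocks.lean` l.189; consumed by [QW8] Thm 2.5, `qw8Sufficiency_of_geometricFacts`):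

  `∀ X p q (x ∈ alg X p) (y ∈ alg X q), castCoh X _ (x ∪ y) ∈ alg X (p + q)`.

The general statement «`Nᵖ H²ᵖ ∪ N^q H^{2q} ⊆ N^{p+q} H^{2(p+q)}` on a smooth projective complex variety» (Voisin II
Prop. 9.20, Fulton Cor. 19.2 (b)) is a THEOREM of the tree:
`Summit.HodgeConjecture.HodgeConjecture.Theorems.Voisin2003_cupProduct_algebraicClasses_holds` (diagonal pull-back +
`fulton1998_map_mem_algebraicClasses_holds`).  This file gives its RATIONAL form on the model's carriers, in the degree
`2p + 2q` in which the model's cup product lands (`cup_mem_supportedClasses`), so that the package's degree transport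
`castCoh` (a `subst`) is the only thing left to the instantiation; and the `PicardCM.Var` form.  (The degree-`(1,1)`
case is M9 `Fact_cup_alg`, `CycleClassFacts.var_cup_alg`.)
-/

noncomputable section

open CategoryTheory
open Literature.AlgebraicTopology.SingularHomology
open Literature.AlgebraicGeometry.Motives (SchemeOver ComplexPoints IsSmoothProjective bettiCohomology)
open Literature.AlgebraicGeometry.HodgeTheory
open Literature.NumberTheory.Automorphic.PicardCM

namespace Summit.HodgeConjecture.CorCM.Model

section General

variable {n : ℕ} {X : SchemeOver ℂ}

/-- **Cup product of rational algebraic classes, all codimensions** (Voisin II Prop. 9.20): for `x ∈ alg X p`,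
`y ∈ alg X q` the complexification of `x ∪ y ∈ H^{2p+2q}(X(ℂ); ℚ)` lies in `N^{p+q} H^{2p+2q}(X(ℂ); ℂ)`. -/
theorem cup_mem_supportedClasses (hX : IsSmoothProjective n X) {p q : ℕ} {x : bettiCohomology X (2 * p)}
    {y : bettiCohomology X (2 * q)} (hx : x ∈ ratAlgebraicClasses X p) (hy : y ∈ ratAlgebraicClasses X q) :
    ofRatClass (ComplexPoints X) (2 * p + 2 * q) (BettiUniverse.cup X (2 * p) (2 * q) x y) ∈
      supportedClasses X (2 * p + 2 * q) (p + q) := by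
  rw [mem_ratAlgebraicClasses_iff] at hx hy
  rw [ofRatClass_cup]
  exact (cupProduct_mem_supportedClasses_congr (two_mul_add_two_mul p q) rfl rfl _ _).1
    (Summit.HodgeConjecture.HodgeConjecture.Theorems.Voisin2003_cupProduct_algebraicClasses_holds hX hx hy)

/-- The same after any degree transport `2p + 2q = k` written with `Eq.rec` on the rational class
(the package's `castCoh`): membership in `ratAlgebraicClasses X (p+q)` once `k = 2 (p + q)`. -/
theorem cup_mem_ratAlgebraicClasses (hX : IsSmoothProjective n X) {p q : ℕ} {x : bettiCohomology X (2 * p)}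
    {y : bettiCohomology X (2 * q)} (hx : x ∈ ratAlgebraicClasses X p) (hy : y ∈ ratAlgebraicClasses X q)
    (T : bettiCohomology X (2 * p + 2 * q) ≃ₗ[ℚ] bettiCohomology X (2 * (p + q)))
    (hT : ∀ z, ofRatClass (ComplexPoints X) (2 * (p + q)) (T z) =
      (two_mul_add_two_mul p q) ▸ ofRatClass (ComplexPoints X) (2 * p + 2 * q) z) :
    T (BettiUniverse.cup X (2 * p) (2 * q) x y) ∈ ratAlgebraicClasses X (p + q) := by
  rw [mem_ratAlgebraicClasses_iff, hT]
  have h := cup_mem_supportedClasses hX hx hy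
  revert h
  generalize ofRatClass (ComplexPoints X) (2 * p + 2 * q) (BettiUniverse.cup X (2 * p) (2 * q) x y) = c
  generalize two_mul_add_two_mul p q = e
  revert c
  generalize 2 * p + 2 * q = k at e ⊢
  subst e
  exact fun c h ↦ h

end General

section PicardCMVar

/-- `Fact_cupAlg`-shape on `PicardCM.Var`, before the degree transport: for the model universe
`universeOf hHD hI hU h₃`, `x ∈ alg X p`, `y ∈ alg X q` imply that the complexified cup product lies in
`N^{p+q} H^{2p+2q}` (the instantiation applies the package's `castCoh`, a `subst`, to reach `alg X (p+q)`). -/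
theorem var_cupAlg (hU : BallQuotientUniformisedDatum) (h₃ : CMAbelianVarietyRealised) (v : Var) {p q : ℕ}
    {x : Var.Coh hU h₃ v (2 * p)} {y : Var.Coh hU h₃ v (2 * q)} (hx : x ∈ Var.alg hU h₃ v p)
    (hy : y ∈ Var.alg hU h₃ v q) :
    ofRatClass (ComplexPoints (Var.scheme hU h₃ v)) (2 * p + 2 * q)
        (BettiUniverse.cup (Var.scheme hU h₃ v) (2 * p) (2 * q) x y) ∈
      supportedClasses (Var.scheme hU h₃ v) (2 * p + 2 * q) (p + q) :=
  cup_mem_supportedClasses (Var.isSmoothProjective hU h₃ v) hx hy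

end PicardCMVar

end Summit.HodgeConjecture.CorCM.Model

end
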